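import Summits.BirchSwinnertonDyer.BirchSwinnertonDyer.Theorems.ByReductionTypeAtTwoSupersingularConjATwoGoodSSRowStampsB
import Summits.BirchSwinnertonDyer.BirchSwinnertonDyer.Theorems.ByReductionTypeAtTwoFineSelmerConjAAtTwoAdditivePotGoodClassNumberOddCriterion
import HarnessLib

/-!
# Route `ByReductionTypeAtTwo` (rung K4), crux `SupersingularRankZeroAtTwo` (item stmt-BirchSwinnertonDyer-19097), v2.12 (α) `FineMuZeroOnHabitatAtTwo`:
# KERNEL CLASS-NUMBER CERTIFICATE, part C — the `h = 3` field `d = −588` (`X³ − X² + 5X + 1`) by CUBE witnesses, and the kernel upgrades of the two rows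
# `147b1`, `147c1` it carries: ALL 30 rows of the h12 tranche now hold modulo Lim 2017 Thm. 3.5 ALONE
# (a `--supports 19097` file; seat `bsd-2adic-t42` GEN 43, hand h12 (3); sequel of `…GoodSSRowFieldCertificatesA/B`, `…GoodSSRowKernelStamps`)

HONEST LABEL (cell `bsd-2adic`, D-0036/D-0054): §1 UNCONDITIONAL kernel arithmetic; §2 conditional on `hLim2` (Lim 2017 Thm. 3.5 at `2`) BY NAME and NOTHING
ELSE; per-row statements; (α) is class-wide and NOT discharged; CDC_H closed MOD PRINT hPT; nothing booked; BSD proved for no curve.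

THE CERTIFICATE (k4-w1 GEN 6 criterion `odd_classNumber_of_cubeCertificate` + `pow_three_eq_span_of_cert`, here with `Or.inr` CUBE witnesses since the ideals
of norm `2, 3, 5` are NOT principal — `h = 3`, PARI kit j343820 `Cl = [3]`, `bnfcertify = 1`): `g = X³ − X² + 5X + 1`, `|disc| = 588 = |d|` (index `1`), `M_K < 7`;
for each prime `ℓ < 7` and root `a` of `g mod ℓ` an element `ω = x + yθ + zθ²` with `ℓ ∣ x + ya + za²`, `|N(ω)| = ℓ³`, a Bézout identity
`U(θ)·ω = (θ − a)^e + ℓ·W(θ)` and `ℓ² ∤ g(a + ℓt)`, so that `(ω) = I³` for the ideal `I ∋ ℓ, θ − a` of norm `ℓ` (4 cube witnesses, found in 0.5 s by k4w3's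
`index3.witness_for` / `cubiccert5.engine_solve_generators`, CHECKED HERE by the kernel). Hence every class has order dividing `3`: `h` is ODD.

References: [Marcus1977] Ch. 5 Thm. 35–37, Cor. 2; [Cohen1993] §4.8.2, §6.3; [Lim2017FineSelmer] Thm. 3.5, Lemma 3.2; [CoatesSujatha2005] (A); kit j343820.
-/

set_option autoImplicit false
-- sibling precedent (`…GoodSSRowFieldCertificatesA.lean`): the directory name repeats the summit name
set_option linter.dupNamespace false

noncomputable section

open scoped Classical IntermediateField NumberField Real nonZeroDivisors

namespace Summit.BirchSwinnertonDyer.BirchSwinnertonDyer.Theorems.AddKatoTwo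

open WeierstrassCurve Field Polynomial IsDedekindDomain NumberField Literature.NumberTheory.EllipticCurves
  Literature.NumberTheory.GaloisRepresentations Literature.NumberTheory.IwasawaTheory

/-! ## §1 The certificate: `h` odd (`= 3`) for the field of `X³ − X² + 5X + 1` (`d = −588`) -/

section Certificate

variable (K : Type) [Field K] [NumberField K]

/-- `X³ − X² + 5X + 1` is irreducible over `ℚ` (no root mod `13`). -/
theorem irreducible_cubic_twoDivField_d588n : Irreducible (Cubic.toPoly ⟨1, ((-1 : ℤ) : ℚ), ((5 : ℤ) : ℚ), ((1 : ℤ) : ℚ)⟩) :=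
  haveI : Fact (Nat.Prime 13) := ⟨by norm_num⟩
  irreducible_cubic_of_no_root_zmod 13 (by decide)

/-- **`h` is ODD for every cubic number field whose integers contain a root `θ` of `X³ − X² + 5X + 1`** (`|disc| = 588`, index `1`, `M_K < 7`; `h = 3` in
PARI): a CUBE certificate — for every prime `ℓ < 7` and every root `a` of the cubic mod `ℓ` an element `x + yθ + zθ²` generating the CUBE of the ideal
`I ∋ ℓ, θ − a` of norm `ℓ` (listed in the proof with its Bézout identity and lift datum `t`). KERNEL. [cite: Marcus1977, Ch. 5 Thm. 37 and Cor. 2] [cite: Cohen1993, §6.3] -/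
theorem odd_classNumber_of_root_twoDivField_d588n (h3 : Module.finrank ℚ K = 3) (b : 𝓞 K)
    (hb : b ^ 3 + (-1 : ℤ) * b ^ 2 + (5 : ℤ) * b + (1 : ℤ) = 0) : Odd (NumberField.classNumber K) := by
  have hirr := irreducible_cubic_twoDivField_d588n
  have hd : |NumberField.discr K| ≤ (588 : ℕ) :=
    (abs_discr_le_abs_cubic_discr K h3 b hirr hb).trans (by simp only [Cubic.discr]; norm_num)
  refine odd_classNumber_of_cubeCertificate K h3 (B := 7)
    (minkowskiBound_lt_of_sqrt_le K h3 hd (s := 24.25)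
      ((Real.sqrt_le_sqrt (by norm_num : ((588 : ℕ) : ℝ) ≤ (24.25 : ℝ) ^ 2)).trans (Real.sqrt_sq (by norm_num)).le)
      (by norm_num)) ?_
  intro ℓ hℓB hℓ J hJ
  interval_cases ℓ <;> norm_num at hℓ
  · -- `ℓ = 2`: roots [1]
    refine pow_three_eq_span_of_cert K h3 b hirr hb (by norm_num) (fun a ha hdvd => ?_) hJ
    interval_cases a <;> norm_num at hdvd
    · exact Or.inr ⟨(0), (-2), (0), 1, by norm_num, by norm_num,
        ⟨_, by rw [Nat.cast_one, one_mul]⟩, by norm_num,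
        ⟨3, (0), (0), (0), (1), (1), (1), by push_cast; linear_combination (((-1 : ℤ) : 𝓞 K) + ((0 : ℤ) : 𝓞 K) * b) * hb⟩, ⟨0, by norm_num⟩⟩
  · -- `ℓ = 3`: roots [1, 2]
    refine pow_three_eq_span_of_cert K h3 b hirr hb (by norm_num) (fun a ha hdvd => ?_) hJ
    interval_cases a <;> norm_num at hdvd
    · exact Or.inr ⟨(-1), (-1), (-1), 1, by norm_num, by norm_num,
        ⟨_, by rw [Nat.cast_one, one_mul]⟩, by norm_num,
        ⟨2, (2), (0), (0), (-1), (0), (-1), by push_cast; linear_combination (((0 : ℤ) : 𝓞 K) + ((0 : ℤ) : 𝓞 K) * b) * hb⟩, ⟨0, by norm_num⟩⟩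
    · exact Or.inr ⟨(1), (-2), (0), 1, by norm_num, by norm_num,
        ⟨_, by rw [Nat.cast_one, one_mul]⟩, by norm_num,
        ⟨1, (1), (0), (0), (1), (-1), (0), by push_cast; linear_combination (((0 : ℤ) : 𝓞 K) + ((0 : ℤ) : 𝓞 K) * b) * hb⟩, ⟨0, by norm_num⟩⟩
  · -- `ℓ = 5`: roots [2]
    refine pow_three_eq_span_of_cert K h3 b hirr hb (by norm_num) (fun a ha hdvd => ?_) hJ
    interval_cases a <;> norm_num at hdvd
    · exact Or.inr ⟨(1), (-2), (2), 1, by norm_num, by norm_num,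
        ⟨_, by rw [Nat.cast_one, one_mul]⟩, by norm_num,
        ⟨1, (0), (1), (0), (0), (-2), (0), by push_cast; linear_combination (((2 : ℤ) : 𝓞 K) + ((0 : ℤ) : 𝓞 K) * b) * hb⟩, ⟨0, by norm_num⟩⟩

/-- `2 ∤ #Cl(𝓞 ℚ(θ))` for every root `θ ∈ ℚ̄` of `X³ − X² + 5X + 1` (`d = −588`, `h = 3`), by the kernel cube certificate above. [folklore] -/
theorem not_two_dvd_card_classGroup_twoDivField_d588n {θ : AlgebraicClosure ℚ}
    (hθ : aeval θ (Cubic.toPoly ⟨1, ((-1 : ℤ) : ℚ), ((5 : ℤ) : ℚ), ((1 : ℤ) : ℚ)⟩) = 0) :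
    ¬ 2 ∣ Nat.card (ClassGroup (𝓞 (IntermediateField.adjoin ℚ {θ}))) :=
  not_two_dvd_card_classGroup_adjoin_of_forall_cubicField_odd irreducible_cubic_twoDivField_d588n
    (odd_classNumber_of_root_twoDivField_d588n) hθ

end Certificate

/-! ## §2 Kernel upgrades of the rows `147b1`, `147c1` -/

/-! ### Row `147b1` = `[0, 1, 1, -114, 473]` (`a₂(E) = 2`; `L_W`: `x³ − x² + 5x + 1`, `d = −588`, `h = 3`) -/

/-- **(A)₂ for `147b1` modulo Lim 2017 Thm. 3.5 (`hLim2`) ALONE — NO displayed datum.** Generator swap: `θ = (313/49) + (-13/98)·β + (-1/196)·β²` is a root of `g = X³ − X² + 5X + 1` (`d = −588`) and `β = (-48) + (14)·θ + (-14)·θ²`, so `ℚ(P) = ℚ(β) = ℚ(θ)`; `2 ∤ #Cl(𝓞 ℚ(θ))` BY THE KERNEL (cube certificate `odd_classNumber_of_root_twoDivField_d588n` (this file)). Row data (Cremona `allcurves`/`allbsd`): minimal model `[0,1,1,-114,473]`, `N = 147`, `a₂(E) = 2` (good supersingular at `2`), `r = 0`, `#tors = 1`, non-CM; `2`-division cubic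 of `β = 4x(P)`: `X³ + 4X² − 1824X + 30288`; Eisenstein cubic of `π = 2x(P)`: `Y³ + 2Y² − 456Y + 3786`; `L_W = ℚ(β) ≅ ℚ[x]/(x³ − x² + 5x + 1)`, complex cubic (Δ_E < 0), `d(L_W) = −588`, `h(L_W) = 3` (`Cl = [3]`) (kit j343820: polredabs/bnfinit, `bnfcertify = 1`). [cite: Lim2017FineSelmer, §3 Thm. 3.5 and Lemma 3.2] [cite: CoatesSujatha2005, §3 statement (A)] -/
theorem conjA_two_147b1
    (hLim2 : Lim2017.thm35_at_two_fineSelmerDual_moduleFinite_of_classicalMuVanishes_of_le_divisionField_four)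
    (κ : ZpExtension ℚ 2) (hκ : κ.IsCyclotomic) :
    haveI := isElliptic_147b1
    ∃ (γ : absoluteGaloisGroup ℚ) (D : ((⟨0, 1, 1, -114, 473⟩ : WeierstrassCurve ℤ).baseChange ℚ).FineSelmerDualData κ γ),
      Module.Finite ℤ_[2] (RestrictScalars ℤ_[2] (IwasawaAlgebra 2) D.X) := by
  haveI := isElliptic_147b1
  refine conjA_two_goodSSModel_of_generator hLim2 (1) (-114) (473) (-1) (5) (1) (313/49) (-13/98) (-1/196) (-48) (14) (-14)
    (fun β θ hβ hθ ↦ ?_) (fun θ hθ ↦ not_two_dvd_card_classGroup_twoDivField_d588n hθ) κ hκ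
  subst hθ; push_cast at hβ ⊢
  exact ⟨by linear_combination (((7855 : AlgebraicClosure ℚ) / 941192) + ((1 : AlgebraicClosure ℚ) / 1882384) * β + ((-37 : AlgebraicClosure ℚ) / 3764768) * β ^ 2 + ((-1 : AlgebraicClosure ℚ) / 7529536) * β ^ 3) * hβ,
    by linear_combination (-1 : AlgebraicClosure ℚ) * (((-6 : AlgebraicClosure ℚ) / 343) + ((-1 : AlgebraicClosure ℚ) / 2744) * β) * hβ⟩

/-- **`FineMuZeroAt (147b1 ⊗ ℚ) 2` modulo `hLim2` ALONE** (kernel bit via the `d = −588` generator swap). [cite: Lim2017FineSelmer, §3 Thm. 3.5 and Lemma 3.2] [cite: CoatesSujatha2005, §3 statement (A)] -/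
theorem fineMuZeroAt_two_147b1
    (hLim2 : Lim2017.thm35_at_two_fineSelmerDual_moduleFinite_of_classicalMuVanishes_of_le_divisionField_four) :
    haveI := isElliptic_147b1
    Literature.NumberTheory.EllipticCurves.Rank1Residual.FineMuZeroAt ((⟨0, 1, 1, -114, 473⟩ : WeierstrassCurve ℤ).baseChange ℚ) 2 :=
  haveI := isElliptic_147b1
  Literature.NumberTheory.EllipticCurves.Rank1Residual.ConjAAt.fineMuZeroAt (conjA_two_147b1 hLim2)

/-! ### Row `147c1` = `[0, -1, 1, -2, -1]` (`a₂(E) = 2`; `L_W`: `x³ − x² + 5x + 1`, `d = −588`, `h = 3`) -/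

/-- **(A)₂ for `147c1` modulo Lim 2017 Thm. 3.5 (`hLim2`) ALONE — NO displayed datum.** Generator swap: `θ = (5) + (3/2)·β + (-1/4)·β²` is a root of `g = X³ − X² + 5X + 1` (`d = −588`) and `β = (8) + (-2)·θ + (2)·θ²`, so `ℚ(P) = ℚ(β) = ℚ(θ)`; `2 ∤ #Cl(𝓞 ℚ(θ))` BY THE KERNEL (cube certificate `odd_classNumber_of_root_twoDivField_d588n` (this file)). Row data (Cremona `allcurves`/`allbsd`): minimal model `[0,-1,1,-2,-1]`, `N = 147`, `a₂(E) = 2` (good supersingular at `2`), `r = 0`, `#tors = 1`, non-CM; `2`-division cubic of `β = 4x(P)`: `X³ − 4X² − 32X − 48`; Eisenstein cubic of `π = 2x(P)`: `Y³ − 2Y² − 8Y − 6`; `L_W = ℚ(β) ≅ ℚ[x]/(x³ − x² + 5x + 1)`, complex cubic (Δ_E < 0), `d(L_W) = −588`, `h(L_W) = 3` (`Cl = [3]`) (kit j343820: polredabs/bnfinit, `bnfcertify = 1`). [cite: Lim2017FineSelmer, §3 Thm. 3.5 and Lemma 3.2] [cite: CoatesSujatha2005, §3 statement (A)] -/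
theorem conjA_two_147c1
    (hLim2 : Lim2017.thm35_at_two_fineSelmerDual_moduleFinite_of_classicalMuVanishes_of_le_divisionField_four)
    (κ : ZpExtension ℚ 2) (hκ : κ.IsCyclotomic) :
    haveI := isElliptic_147c1
    ∃ (γ : absoluteGaloisGroup ℚ) (D : ((⟨0, -1, 1, -2, -1⟩ : WeierstrassCurve ℤ).baseChange ℚ).FineSelmerDualData κ γ),
      Module.Finite ℤ_[2] (RestrictScalars ℤ_[2] (IwasawaAlgebra 2) D.X) := by
  haveI := isElliptic_147c1
  refine conjA_two_goodSSModel_of_generator hLim2 (-1) (-2) (-1) (-1) (5) (1) (5) (3/2) (-1/4) (8) (-2) (2)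
    (fun β θ hβ hθ ↦ ?_) (fun θ hθ ↦ not_two_dvd_card_classGroup_twoDivField_d588n hθ) κ hκ
  subst hθ; push_cast at hβ ⊢
  exact ⟨by linear_combination (((-21 : AlgebraicClosure ℚ) / 8) + ((-7 : AlgebraicClosure ℚ) / 16) * β + ((7 : AlgebraicClosure ℚ) / 32) * β ^ 2 + ((-1 : AlgebraicClosure ℚ) / 64) * β ^ 3) * hβ,
    by linear_combination (-1 : AlgebraicClosure ℚ) * ((-1 : AlgebraicClosure ℚ) + ((1 : AlgebraicClosure ℚ) / 8) * β) * hβ⟩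

/-- **`FineMuZeroAt (147c1 ⊗ ℚ) 2` modulo `hLim2` ALONE** (kernel bit via the `d = −588` generator swap). [cite: Lim2017FineSelmer, §3 Thm. 3.5 and Lemma 3.2] [cite: CoatesSujatha2005, §3 statement (A)] -/
theorem fineMuZeroAt_two_147c1
    (hLim2 : Lim2017.thm35_at_two_fineSelmerDual_moduleFinite_of_classicalMuVanishes_of_le_divisionField_four) :
    haveI := isElliptic_147c1
    Literature.NumberTheory.EllipticCurves.Rank1Residual.FineMuZeroAt ((⟨0, -1, 1, -2, -1⟩ : WeierstrassCurve ℤ).baseChange ℚ) 2 :=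
  haveI := isElliptic_147c1
  Literature.NumberTheory.EllipticCurves.Rank1Residual.ConjAAt.fineMuZeroAt (conjA_two_147c1 hLim2)

end Summit.BirchSwinnertonDyer.BirchSwinnertonDyer.Theorems.AddKatoTwo

end
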